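import Literature.NumberTheory.Automorphic.PlaneLatticesCompanionAffineStrata                     -- ★ p851805 (P5c) part I: `valuation_sq_add_mul_sub_eq_max` (parity), brings ★ (β2′-i) `exists_valuation_eq_valuation_zpow`, `valuation_zpow_le_valuation_zpow_iff`
import Literature.NumberTheory.Rogawski1990.UnitStableOrbitalIntegralCyclicFrameAffineCentreTrace  -- ★ p851815: `antidiagTrace_eq_div_mul_sub`, `valuation_antidiagTrace_le`, `mul_map_trace_eq_trace_of_antidiagTrace`
import HarnessLib

/-!
# The centre-trace bound is automatic: `|d·σa − a| ≤ |ϖ^(j+1)|` for EVERY admissible Eisenstein centre of a unitary companion, hence `|β·σa + σβ·a| ≤ |ϖ^(j+1+e)|`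

Topic `NumberTheory/Rogawski1990`; namespace `Literature.NumberTheory.Automorphic.UnitaryGroup`.  THEOREMS ONLY (no definition, no instance, no notation, no named
fact, no `sorry`).  Cell `pub/hodgecm-mathlib`, F0∕P3c LH4 list, tail of (P5d) (★ p851800 socket, ★ p851815 centre trace, ★ p851827 dictionary): the `hβa′` binder of the
Eisenstein-centred companion count (★ p851805 ∕ (P5c) part II) DISCHARGED from the frame relations and the admissibility of the centre alone — no eigen-field package, any
residue characteristic.  HC_CM is proved only modulo the printed citations until rung 0 closes; this file is unconditional, elementary and 2-free.

THE ARGUMENT.  In the isotropic cyclic frame (`d·σβ = −β`, `β ≠ 0`, `β·σt + σβ·t = 0`, `σ` an involution) one has `σd = d⁻¹` and `σt = t∕d` (§1), hence for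
`χ(X) = X² − tX + d`: **`χ(d·σx) = d²·σ(χ(x))`** — the twisted reflection `x ↦ d·σx` preserves `|χ|`.  Let `(a, f, e′)` be ADMISSIBLE: `t − 2a = f`, `χ(a) = −e′`,
`|f| ≤ |ϖ^(j+1)|`, `|e′| = |ϖ^(2j+1)|`, and put `δ := d·σa − a`.  Then `χ(a + δ) = χ(d·σa)` has valuation `|e′|`, while `χ(a + δ) = δ² − fδ − e′` has valuation
`max(|δ|², |e′|)` (★ p851805 `valuation_sq_add_mul_sub_eq_max`: even against odd powers of `|ϖ|`, no cancellation).  So `|δ|² ≤ |ϖ^(2j+1)|`, and by integrality of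
exponents **`|d·σa − a| ≤ |ϖ^(j+1)|`** (§2) — the admissible centres form one class `a₀ + 𝔪^(j+1)`, stable under `x ↦ d·σx`.  With ★ p851815 `valuation_antidiagTrace_le`:
**`|β·σa + σβ·a| ≤ |ϖ^(j+1+e)|`** (§3), the `hβa′` hypothesis of the Eisenstein-centred count, from frame + admissibility only.

* §1 `det_mul_map_det_eq_one_of_antidiag`, `charpoly_det_mul_map_eq`.
* §2 **`valuation_det_mul_map_sub_le_of_affine`**.
* §3 **`valuation_antidiagTrace_le_of_affine`**.

## References
* [Flicker1998UnitaryFL] Y. Z. Flicker, *Elementary proof of the fundamental lemma for a unitary group*, Canad. J. Math. 50 (1998), §6 p. 97.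
* [Rogawski1990] J. D. Rogawski, *Automorphic Representations of Unitary Groups in Three Variables* (1990), §3.6 p. 31; §4.9 Lemma 4.9.3 p. 56.
* [Serre1979] J.-P. Serre, *Local Fields*, GTM 67 (1979), Ch. I §6 (Eisenstein equations), Ch. V §2.
-/

set_option autoImplicit false

noncomputable section

open Matrix ValuativeRel
open scoped ValuativeRel Matrix MatrixGroups

namespace Literature.NumberTheory.Automorphic.UnitaryGroup

/-! ## §1 The twisted reflection `x ↦ d·σx` preserves `|χ|` -/

section Algebra

variable {K : Type*} [Field K] (σ : K →+* K)

/-- **`d·σd = 1`** from the frame relation `d·σβ = −β` (`β ≠ 0`, `σ` an involution): apply `σ` and compare. [cite: Flicker1998UnitaryFL, §6 p. 97] [cite: Rogawski1990, §3.6 p. 31] -/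
theorem det_mul_map_det_eq_one_of_antidiag (hσσ : ∀ x, σ (σ x) = x) {β d : K} (hdβ : d * σ β = -β) (hβ0 : β ≠ 0) : d * σ d = 1 := by
  have h1 : σ d * β = -σ β := by
    have := congrArg σ hdβ
    rwa [map_mul, hσσ, map_neg] at this
  -- `d·σd·β = d·(−σβ) = β`
  have h2 : (d * σ d) * β = β := by linear_combination d * h1 - hdβ
  exact mul_right_cancel₀ hβ0 (h2.trans (one_mul β).symm)

/-- **`χ(d·σx) = d²·σ(χ(x))`** for `χ(X) = X² − tX + d`, when `d·σd = 1` and `d·σt = t` (the unitarity relations of the companion in the frame).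
[cite: Rogawski1990, §3.6 p. 31] [cite: Serre1979, Ch. I §6] -/
theorem charpoly_det_mul_map_eq {d t : K} (hσd : d * σ d = 1) (hdt : d * σ t = t) (x : K) :
    (d * σ x) * (d * σ x) - t * (d * σ x) + d = d ^ 2 * σ (x * x - t * x + d) := by
  rw [map_add, map_sub, map_mul, map_mul]
  linear_combination (d * σ x) * hdt - d * hσd

end Algebra

/-! ## §2 The bound `|d·σa − a| ≤ |ϖ^(j+1)|` for every admissible centre -/

section Bound

variable {F : Type*} [Field F] [ValuativeRel F] {ϖ : F} (hϖ : IsUniformizingElement ϖ) [IsDiscreteValuationRing 𝒪[F]] (σ : F →+* F)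
  (hσv : ∀ x, valuation F (σ x) = valuation F x)

include hϖ hσv in
/-- **THE CENTRE BOUND** (frame + admissibility only): if `|d| = 1`, `d·σd = 1`, `d·σt = t`, and `(a, f, e′)` is admissible — `t − 2a = f`, `a² − ta + d = −e′`,
`|f| ≤ |ϖ^(j+1)|`, `|e′| = |ϖ^(2j+1)|` — then `|d·σa − a| ≤ |ϖ^(j+1)|`.  (With `δ = d·σa − a`: `|δ² − fδ − e′| = |χ(dσa)| = |e′|` by §1, and `= max(|δ|², |e′|)` by ★
`valuation_sq_add_mul_sub_eq_max`; so `|δ|² ≤ |ϖ|^(2j+1)`, whence `|δ| ≤ |ϖ|^(j+1)` by integrality of the exponent.) [cite: Flicker1998UnitaryFL, §6 p. 97] [cite: Serre1979, Ch. I §6] -/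
theorem valuation_det_mul_map_sub_le_of_affine {t d a f e' : F} {j : ℕ} (hd : valuation F d = 1) (hσd : d * σ d = 1) (hdt : d * σ t = t)
    (hf : valuation F f ≤ valuation F (ϖ ^ (j + 1))) (hj : valuation F e' = valuation F (ϖ ^ (2 * j + 1)))
    (htf : t - 2 * a = f) (hde : a * a - t * a + d = -e') :
    valuation F (d * σ a - a) ≤ valuation F (ϖ ^ (j + 1)) := by
  have h0 := hϖ.ne_zero
  set δ := d * σ a - a with hδ
  -- `χ(a + δ) = δ² − fδ − e′ = χ(d·σa) = d²·σ(χ(a)) = d²·σ(−e′)`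
  have hχ : (-δ) ^ 2 + f * (-δ) - e' = d ^ 2 * σ (-e') := by
    rw [← hde, ← charpoly_det_mul_map_eq σ hσd hdt a, hδ]
    linear_combination (d * σ a - a) * htf - hde
  have hval : valuation F ((-δ) ^ 2 + f * (-δ) - e') = valuation F e' := by
    rw [hχ, map_mul, map_pow, hd, one_pow, one_mul, hσv, Valuation.map_neg]
  have hmax := valuation_sq_add_mul_sub_eq_max hϖ hf hj (-δ)
  rw [hval, neg_sq] at hmax
  have hδ2 : valuation F (δ ^ 2) ≤ valuation F e' := hmax ▸ le_max_left _ _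
  -- integrality of the exponent
  by_cases hδ0 : δ = 0
  · rw [hδ0, map_zero]; exact zero_le
  obtain ⟨m, hm⟩ := exists_valuation_eq_valuation_zpow hϖ hδ0
  have hδ2' : valuation F (ϖ ^ (2 * m)) ≤ valuation F (ϖ ^ ((2 * j + 1 : ℕ) : ℤ)) := by
    rw [zpow_natCast, ← hj]
    calc valuation F (ϖ ^ (2 * m)) = valuation F (δ ^ 2) := by
            rw [map_pow, hm, ← map_pow, ← zpow_natCast (ϖ ^ m), ← _root_.zpow_mul, mul_comm]; rfl
      _ ≤ valuation F e' := hδ2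
  rw [valuation_zpow_le_valuation_zpow_iff hϖ] at hδ2'
  rw [hm, ← zpow_natCast, valuation_zpow_le_valuation_zpow_iff hϖ]
  push_cast at hδ2' ⊢
  omega

end Bound

/-! ## §3 `hβa′` from frame + admissibility -/

section Trace

variable {F : Type*} [Field F] [ValuativeRel F] {ϖ : F} (hϖ : IsUniformizingElement ϖ) [IsDiscreteValuationRing 𝒪[F]] (σ : F →+* F)
  (hσσ : ∀ x, σ (σ x) = x) (hσv : ∀ x, valuation F (σ x) = valuation F x)

include hϖ hσσ hσv in
/-- **THE CENTRE-TRACE HYPOTHESIS DISCHARGED**: in the frame of ★ `exists_antidiag_companion_affine_frame_ncard_eq_of_unitary[_antidiagOne]` (`d·σβ = −β`, `β ≠ 0`,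
`β·σt + σβ·t = 0`, `|d| = 1`, `|β| = |ϖ^e|`) every admissible centre (`t − 2a = f`, `a² − ta + d = −e′`, `|f| ≤ |ϖ^(j+1)|`, `|e′| = |ϖ^(2j+1)|`) satisfies
`|β·σa + σβ·a| ≤ |ϖ^(j+1+e)|` — the `hβa′` input of the Eisenstein-centred companion count, with no eigen-field package. [cite: Flicker1998UnitaryFL, §6 p. 97] [cite: Serre1979, Ch. I §6; Ch. V §2] -/
theorem valuation_antidiagTrace_le_of_affine {β d t a f e' : F} {e j : ℕ} (hdβ : d * σ β = -β) (hβ0 : β ≠ 0) (htr : β * σ t + σ β * t = 0)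
    (hd : valuation F d = 1) (hβ : valuation F β = valuation F (ϖ ^ e))
    (hf : valuation F f ≤ valuation F (ϖ ^ (j + 1))) (hj : valuation F e' = valuation F (ϖ ^ (2 * j + 1)))
    (htf : t - 2 * a = f) (hde : a * a - t * a + d = -e') :
    valuation F (β * σ a + σ β * a) ≤ valuation F (ϖ ^ (j + 1 + e)) := by
  have hd0 : d ≠ 0 := fun h => by rw [h, map_zero] at hd; exact zero_ne_one hd
  have hσd : d * σ d = 1 := det_mul_map_det_eq_one_of_antidiag σ hσσ hdβ hβ0
  have hdt : d * σ t = t := mul_map_trace_eq_trace_of_antidiagTrace σ hdβ hd0 hβ0 htr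
  exact valuation_antidiagTrace_le σ hdβ hd hβ (valuation_det_mul_map_sub_le_of_affine hϖ σ hσv hd hσd hdt hf hj htf hde)

end Trace

end Literature.NumberTheory.Automorphic.UnitaryGroup
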